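import Summits.BirchSwinnertonDyer.BirchSwinnertonDyer.Theorems.CyclotomicUntwistNineGoodModelTransport
import Literature.NumberTheory.EllipticCurves.FormalGroupOmegaInvarianceProofs
import Literature.NumberTheory.EllipticCurves.FormalGroupLogHomProofs
import Literature.AlgebraicGeometry.Resolution.MvPowerSeriesChainRule
import HarnessLib

/-!
# Route `CyclotomicUntwist`: towards «`η = x·ω` is of the second kind» — the `z₁`-derivative of the coboundary of
# `∫(xω − dz/z²)`, the integration lemma, and the reduction of the closed form to ONE algebraic identity

Cell `pub/bsd-wall` (D-0145 line `route-BirchSwinnertonDyer-CyclotomicUntwist`), prover seat `bsd-line-cycu-p3`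
(gen 8), lane «KATZ FROBENIUS MOD ϖ», memo `Cruxes/PSRankOneLowerHalfAtThree/KATZ-FROBENIUS-MOD-VARPI-v1.md` §3.
THEOREMS ONLY (no definition, no named fact, no `sorry`); helper `--supports` K1 = stmt-BirchSwinnertonDyer-21580
(K2 = 21581; print child C2 = 27549 / 27616). BSD is not proved by this file and no crux is.

WHY. After the kernel reductions of the print input `WeierstrassCurve.isDescendedFrobeniusMatrix_exists` (p632401,
p633281, p633233, p633868, p634037, p634969) its residual is «on one good model, `[η_W] ∈ L[ω_W] + L·φ[ω_W]` modulo
bounded denominators» — which presupposes that the second Néron class `Φ = formalEtaIntegral = ∫(xω − dz/z²)` IS a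
class of Katz's `D(Ê/𝓞) ⊗ ℚ`, i.e. that its coboundary `∂Φ = Φ(F(z₁,z₂)) − Φ(z₁) − Φ(z₂)` has bounded (indeed integral)
coefficients. The memo derives the closed form (zw-chord `w = λz + ν` of AEC IV.1, third point `z₃`, `B = w/z³`)

  `∂Φ = −[a₃λ + (a₄ + a₁a₃)ν + 2a₆λν + a₁a₆ν²]·(1 − a₃ν − a₆ν²)⁻¹ + a₃·B(z₃)·z₃²`        (⋆)

(verified by exact series arithmetic to total degree 12), whose right side is visibly in `ℤ[a₁,…,a₆]⟦z₁,z₂⟧`. This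
file proves the TRANSCENDENTAL part of (⋆) and reduces the rest to one polynomial identity in the chord toolkit of
`FormalGroupOmegaInvarianceProofs`:

* §1 `formalEta_mul_pderiv_etaCoboundary` — **`η(z₁)·z₁²F²·∂₁(∂Φ) = z₁²(X(F) − η(F)) − F²(X(z₁) − η(z₁))`**
  (`X = z²x = formalXMulSq`, `η = dz/ω = formalEta`), from `z²Φ′ = XΩ − 1` (cycu-p4's
  `X_sq_mul_derivative_formalEtaIntegral`), the chain rule and the invariance `η(z₁)∂₁F = η(F)`;
* §2 `etaCoboundary_coeff_single_one` — `∂Φ` has no pure-`z₂` terms (`F(0,z₂) = z₂`); `eq_of_pderiv_eq_of_coeff`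
  — over a `ℚ`-algebra two series with equal `∂₁` and equal pure-`z₂` parts are equal;
* §3 **`etaCoboundary_eq_of_pderiv`** — if `S ∈ A⟦z₁,z₂⟧` has no pure-`z₂` terms and
  `η(z₁)·z₁²F²·∂₁S = z₁²(X(F) − η(F)) − F²(X(z₁) − η(z₁))`, then `∂Φ = S`. So «`η` of the second kind» = exhibit an
  integral `S` with these two properties; (⋆)'s right side is the candidate, and §4 `subst_zero_X_etaCandidate` checks
  its pure-`z₂` part vanishes (`λ(0,z) = z²B`, `ν(0,z) = 0`, `z₃(0,z) = i(z)`, `B(i(z))i(z)² = z²B(z)`), leaving exactly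
  the `∂₁`-identity (the zw-form of the slope law `D_P(slope) = x(P) − x(P+Q)`) to a successor.
[cite: Katz1981CrystallineDieudonne, §5.1 (p. 193) and Thm 5.7.2] [cite: SilvermanAEC2009, IV.1 and III.5.1]
-/

set_option autoImplicit false
-- single-conjunct summit: `Summit.BirchSwinnertonDyer.BirchSwinnertonDyer.…` repeats the name by design
set_option linter.dupNamespace false

noncomputable section

open PowerSeries Literature.NumberTheory.EllipticCurves
  Summit.BirchSwinnertonDyer.BirchSwinnertonDyer.Theorems.NineGoodModelTransport
open Literature.AlgebraicGeometry.Resolution (MvPowerSeries.pderiv MvPowerSeries.coeff_pderiv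
  MvPowerSeries.pderiv_X MvPowerSeries.pderiv_C MvPowerSeries.pderiv_powerSeries_subst
  MvPowerSeries.pderiv_powerSeries_subst_X MvPowerSeries.pderiv_subst_pair)

namespace Summit.BirchSwinnertonDyer.BirchSwinnertonDyer.Theorems.EtaSecondKind

/-! ## §1 The `z₁`-derivative of the coboundary of `Φ = ∫(xω − dz/z²)` -/

section Derivative

variable {A : Type*} [CommRing A] [IsDomain A] [Algebra ℚ A] (V : WeierstrassCurve A)

omit [IsDomain A] in
/-- `F²·Φ′(F) = X(F)·Ω(F) − 1` and `u²·Φ′(u) = X(u)·Ω(u) − 1`: the identity `z²Φ′ = XΩ − 1` substituted.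
[cite: Katz1981CrystallineDieudonne, §5.1 (p. 193)] -/
theorem sq_mul_derivative_formalEtaIntegral_subst {τ : Type*} {Γ : MvPowerSeries τ A}
    (hΓ : MvPowerSeries.constantCoeff Γ = 0) :
    Γ ^ 2 * (d⁄dX A V.formalEtaIntegral).subst Γ = V.formalXMulSq.subst Γ * V.formalOmega.subst Γ - 1 := by
  have hs : PowerSeries.HasSubst Γ := PowerSeries.HasSubst.of_constantCoeff_zero hΓ
  have h := congrArg (PowerSeries.subst Γ) (X_sq_mul_derivative_formalEtaIntegral V)
  rw [PowerSeries.subst_mul hs, PowerSeries.subst_pow hs, PowerSeries.subst_X hs, PowerSeries.subst_sub hs,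
    PowerSeries.subst_mul hs, ← PowerSeries.coe_substAlgHom hs, map_one] at h
  rw [PowerSeries.coe_substAlgHom hs] at h
  exact h

/-- **The `z₁`-derivative of the `η`-coboundary.** With `F = formalGroupLaw`, `Φ = formalEtaIntegral`,
`X = formalXMulSq`, `η = formalEta`: `η(z₁)·(z₁²·F²·∂₁(Φ(F) − Φ(z₁) − Φ(z₂))) = z₁²(X(F) − η(F)) − F²(X(z₁) − η(z₁))`
— i.e. `D_{z₁}(∂Φ) = q(F) − q(z₁)` for the invariant derivation `D = η·d/dz` and `q = (X − η)/z²`. Inputs: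
`z²Φ′ = XΩ − 1`, the chain rule, `η(z₁)·∂₁F = η(F)` (invariance of `ω`), `Ωη = 1`.
[cite: SilvermanAEC2009, III.5.1 and IV.1] [cite: Katz1981CrystallineDieudonne, §5.1 (p. 193)] -/
theorem formalEta_mul_pderiv_etaCoboundary :
    V.formalEta.subst (MvPowerSeries.X 0 : MvPowerSeries (Fin 2) A) *
        ((MvPowerSeries.X 0) ^ 2 * V.formalGroupLaw ^ 2 *
          MvPowerSeries.pderiv 0 (V.formalEtaIntegral.subst V.formalGroupLaw -
            V.formalEtaIntegral.subst (MvPowerSeries.X 0 : MvPowerSeries (Fin 2) A) -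
            V.formalEtaIntegral.subst (MvPowerSeries.X 1 : MvPowerSeries (Fin 2) A))) =
      (MvPowerSeries.X 0) ^ 2 * (V.formalXMulSq.subst V.formalGroupLaw - V.formalEta.subst V.formalGroupLaw) -
        V.formalGroupLaw ^ 2 * (V.formalXMulSq.subst (MvPowerSeries.X 0 : MvPowerSeries (Fin 2) A) -
          V.formalEta.subst (MvPowerSeries.X 0 : MvPowerSeries (Fin 2) A)) := by
  classical
  set F := V.formalGroupLaw with hF
  set u : MvPowerSeries (Fin 2) A := MvPowerSeries.X 0 with hu
  have hF0 : MvPowerSeries.constantCoeff F = 0 := V.constantCoeff_formalGroupLaw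
  have hu0 : MvPowerSeries.constantCoeff u = 0 := MvPowerSeries.constantCoeff_X 0
  -- the derivative of the coboundary
  have hd : MvPowerSeries.pderiv 0 (V.formalEtaIntegral.subst F - V.formalEtaIntegral.subst u -
      V.formalEtaIntegral.subst (MvPowerSeries.X 1 : MvPowerSeries (Fin 2) A)) =
      (d⁄dX A V.formalEtaIntegral).subst F * MvPowerSeries.pderiv 0 F - (d⁄dX A V.formalEtaIntegral).subst u := by
    rw [map_sub, map_sub, MvPowerSeries.pderiv_powerSeries_subst hF0, hu, MvPowerSeries.pderiv_powerSeries_subst_X,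
      MvPowerSeries.pderiv_powerSeries_subst_X, if_pos rfl, if_neg (by decide), sub_zero]
  have h1 := sq_mul_derivative_formalEtaIntegral_subst V hF0
  have h2 := sq_mul_derivative_formalEtaIntegral_subst V hu0
  have h3 : V.formalEta.subst u * MvPowerSeries.pderiv 0 F = V.formalEta.subst F :=
    V.formalEta_subst_X_mul_pderiv_formalGroupLaw 0
  have hΩη : V.formalOmega * V.formalEta = 1 := V.formalOmega_mul_formalEta
  have h4 : V.formalOmega.subst F * V.formalEta.subst F = 1 := by
    rw [← PowerSeries.subst_mul (PowerSeries.HasSubst.of_constantCoeff_zero hF0), hΩη,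
      ← PowerSeries.coe_substAlgHom (PowerSeries.HasSubst.of_constantCoeff_zero hF0), map_one]
  have h5 : V.formalOmega.subst u * V.formalEta.subst u = 1 := by
    rw [hu, ← PowerSeries.subst_mul (PowerSeries.HasSubst.X 0), hΩη,
      ← PowerSeries.coe_substAlgHom (PowerSeries.HasSubst.X 0), map_one]
  rw [hd]
  linear_combination (V.formalEta.subst u * u ^ 2 * MvPowerSeries.pderiv 0 F) * h1 -
    (V.formalEta.subst u * F ^ 2) * h2 +
    (u ^ 2 * (V.formalXMulSq.subst F * V.formalOmega.subst F - 1)) * h3 +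
    (u ^ 2 * V.formalXMulSq.subst F) * h4 - (F ^ 2 * V.formalXMulSq.subst u) * h5

end Derivative

/-! ## §2 Integration: `∂₁`-parts and pure-`z₂` parts determine a series over a `ℚ`-algebra -/

section Integration

variable {A : Type*} [CommRing A] [Algebra ℚ A]

/-- Over a `ℚ`-algebra, two series in `z₁, z₂` with the same `∂₁` and the same pure-`z₂` coefficients are equal.
[folklore] -/
theorem eq_of_pderiv_eq_of_coeff {Ψ S : MvPowerSeries (Fin 2) A}
    (hd : MvPowerSeries.pderiv 0 Ψ = MvPowerSeries.pderiv 0 S)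
    (h0 : ∀ n : ℕ, MvPowerSeries.coeff (Finsupp.single 1 n) Ψ = MvPowerSeries.coeff (Finsupp.single 1 n) S) :
    Ψ = S := by
  classical
  rw [← sub_eq_zero]
  ext e
  rw [map_zero]
  by_cases he : e 0 = 0
  · have hes : e = Finsupp.single 1 (e 1) := by
      ext i; fin_cases i
      · simpa using he
      · simp
    rw [hes, map_sub, h0, sub_self]
  · exact coeff_eq_zero_of_pderiv_eq_zero_of_algebra_rat (by rw [map_sub, hd, sub_self]) he

variable [IsDomain A] (V : WeierstrassCurve A)

omit [IsDomain A] in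
/-- **`∂Φ` has no pure-`z₂` terms**: `(Φ(F) − Φ(z₁) − Φ(z₂))(0, z₂) = Φ(z₂) − 0 − Φ(z₂) = 0` (`F(0, z) = z`).
[cite: SilvermanAEC2009, IV.2] -/
theorem etaCoboundary_coeff_single_one (n : ℕ) :
    MvPowerSeries.coeff (Finsupp.single 1 n) (V.formalEtaIntegral.subst V.formalGroupLaw -
      V.formalEtaIntegral.subst (MvPowerSeries.X 0 : MvPowerSeries (Fin 2) A) -
      V.formalEtaIntegral.subst (MvPowerSeries.X 1 : MvPowerSeries (Fin 2) A)) = 0 := by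
  have hs := WeierstrassCurve.hasSubst_zero_X (R := A)
  rw [← coeff_subst_zero_X, MvPowerSeries.subst_sub hs, MvPowerSeries.subst_sub hs,
    mvSubst_powerSeries_subst V.hasSubst_formalGroupLaw hs, mvSubst_powerSeries_subst (PowerSeries.HasSubst.X 0) hs,
    mvSubst_powerSeries_subst (PowerSeries.HasSubst.X 1) hs, V.formalGroupLaw_subst_zero_X,
    WeierstrassCurve.subst_zero_X_X_zero, WeierstrassCurve.subst_zero_X_X_one,
    PowerSeries.subst_zero_of_constantCoeff_zero V.constantCoeff_formalEtaIntegral, sub_zero, sub_self, map_zero]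

/-- **REDUCTION OF «`η` IS OF THE SECOND KIND» TO ONE ALGEBRAIC IDENTITY.** Let `S ∈ A⟦z₁,z₂⟧` have no pure-`z₂`
terms and satisfy `η(z₁)·(z₁²F²·∂₁S) = z₁²(X(F) − η(F)) − F²(X(z₁) − η(z₁))`. Then the coboundary of
`Φ = ∫(xω − dz/z²)` IS `S`: `Φ(F) − Φ(z₁) − Φ(z₂) = S`. (For `S` = the right side of (⋆), an integral series, this is
the membership `[η_W] ∈ D(Ê) ⊗ ℚ`.) [cite: Katz1981CrystallineDieudonne, §5.1 (p. 193)] [cite: SilvermanAEC2009, III.5.1] -/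
theorem etaCoboundary_eq_of_pderiv {S : MvPowerSeries (Fin 2) A}
    (hS0 : ∀ n : ℕ, MvPowerSeries.coeff (Finsupp.single 1 n) S = 0)
    (hS1 : V.formalEta.subst (MvPowerSeries.X 0 : MvPowerSeries (Fin 2) A) *
        ((MvPowerSeries.X 0) ^ 2 * V.formalGroupLaw ^ 2 * MvPowerSeries.pderiv 0 S) =
      (MvPowerSeries.X 0) ^ 2 * (V.formalXMulSq.subst V.formalGroupLaw - V.formalEta.subst V.formalGroupLaw) -
        V.formalGroupLaw ^ 2 * (V.formalXMulSq.subst (MvPowerSeries.X 0 : MvPowerSeries (Fin 2) A) -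
          V.formalEta.subst (MvPowerSeries.X 0 : MvPowerSeries (Fin 2) A))) :
    V.formalEtaIntegral.subst V.formalGroupLaw -
        V.formalEtaIntegral.subst (MvPowerSeries.X 0 : MvPowerSeries (Fin 2) A) -
        V.formalEtaIntegral.subst (MvPowerSeries.X 1 : MvPowerSeries (Fin 2) A) = S := by
  classical
  refine eq_of_pderiv_eq_of_coeff ?_ fun n ↦ by rw [etaCoboundary_coeff_single_one V, hS0]
  -- cancel the non-zero-divisor `η(z₁)·z₁²·F²`
  have key := formalEta_mul_pderiv_etaCoboundary V
  rw [← hS1] at key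
  have hc : MvPowerSeries.constantCoeff (V.formalEta.subst (MvPowerSeries.X 0 : MvPowerSeries (Fin 2) A)) = 1 := by
    rw [← MvPowerSeries.coeff_zero_eq_constantCoeff_apply, coeff_powerSeries_subst_X]
    simp [coeff_zero_eq_constantCoeff, V.constantCoeff_formalEta]
  have hη : V.formalEta.subst (MvPowerSeries.X 0 : MvPowerSeries (Fin 2) A) ≠ 0 := by
    intro h0
    rw [h0, map_zero] at hc
    exact zero_ne_one hc
  have hX : (MvPowerSeries.X 0 : MvPowerSeries (Fin 2) A) ^ 2 ≠ 0 := by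
    refine pow_ne_zero 2 fun h0 ↦ ?_
    have := congrArg (MvPowerSeries.coeff (Finsupp.single 0 1)) h0
    rw [MvPowerSeries.coeff_X, if_pos rfl, map_zero] at this
    exact one_ne_zero this
  have hF : V.formalGroupLaw ^ 2 ≠ 0 := by
    refine pow_ne_zero 2 fun h0 ↦ ?_
    have hs := WeierstrassCurve.hasSubst_zero_X (R := A)
    have := congrArg (MvPowerSeries.subst ![(0 : A⟦X⟧), PowerSeries.X]) h0
    rw [V.formalGroupLaw_subst_zero_X, ← MvPowerSeries.coe_substAlgHom hs, map_zero] at this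
    exact PowerSeries.X_ne_zero this
  have h' := mul_left_cancel₀ hη key
  exact mul_left_cancel₀ (mul_ne_zero hX hF) h'

end Integration

/-! ## §4 The candidate right side of (⋆) has no pure-`z₂` terms -/

section Candidate

variable {R : Type*} [CommRing R] [IsDomain R] (W : WeierstrassCurve R)

/-- **`B(i(z))·i(z)² = z²·B(z)`** (`1/x` is even: `x(−P) = x(P)`), from `i = −z/E`, `w(i) = −w/E`, `w = z³B`
(`E = 1 − a₁z − a₃w`). [cite: SilvermanAEC2009, III.2.3 and IV.1] -/
theorem formalWDivCube_subst_formalNeg_mul_sq :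
    W.formalWDivCube.subst W.formalNeg * W.formalNeg ^ 2 = X ^ 2 * W.formalWDivCube := by
  set E := 1 - C W.a₁ * X - C W.a₃ * W.formalW with hEdef
  set Ei := invOfUnit E 1 with hEidef
  have hE : E * Ei = 1 := W.formalNegDenom_mul_invOfUnit
  have hi : W.formalNeg = -(X * Ei) := W.formalNeg_eq
  have hwi : W.formalW.subst W.formalNeg = -(W.formalW * Ei) := W.formalW_subst_formalNeg
  have hw : W.formalW = X ^ 3 * W.formalWDivCube := W.formalW_eq_X_pow_mul_formalWDivCube
  have hs : PowerSeries.HasSubst W.formalNeg := PowerSeries.HasSubst.of_constantCoeff_zero' W.constantCoeff_formalNeg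
  -- `B(i)·i³ = w(i)`
  have hBi : W.formalWDivCube.subst W.formalNeg * W.formalNeg ^ 3 = W.formalW.subst W.formalNeg := by
    have := congrArg (PowerSeries.subst W.formalNeg) hw
    rw [PowerSeries.subst_mul hs, PowerSeries.subst_pow hs, PowerSeries.subst_X hs] at this
    rw [this]; ring
  -- multiply the claim by the non-zero-divisor `i = −X·Ei` and compare with `B(i)·i³ = −w·Ei = −X³B·Ei`
  have hi0 : W.formalNeg ≠ 0 := by
    intro h0
    have := congrArg (coeff 1) h0
    rw [hi, map_neg, coeff_succ_X_mul, map_zero, neg_eq_zero] at this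
    have h1 : constantCoeff Ei = 1 := by rw [hEidef, constantCoeff_invOfUnit, inv_one, Units.val_one]
    rw [coeff_zero_eq_constantCoeff_apply, h1] at this
    exact one_ne_zero this
  apply mul_right_cancel₀ hi0
  rw [show W.formalWDivCube.subst W.formalNeg * W.formalNeg ^ 2 * W.formalNeg =
      W.formalWDivCube.subst W.formalNeg * W.formalNeg ^ 3 by ring, hBi, hwi, hw, hi]
  ring

/-- **The right side of (⋆) has no pure-`z₂` terms**: at `z₁ = 0`, `λ = z²B`, `ν = 0`, `z₃ = i(z)`, and
`−a₃z²B + a₃B(i)i² = 0`. [cite: SilvermanAEC2009, IV.1] -/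
theorem subst_zero_X_etaCandidate :
    MvPowerSeries.subst ![(0 : R⟦X⟧), PowerSeries.X]
      (-(MvPowerSeries.C W.a₃ * W.formalSlope + MvPowerSeries.C (W.a₄ + W.a₁ * W.a₃) * W.formalIntercept +
          MvPowerSeries.C (2 * W.a₆) * W.formalSlope * W.formalIntercept +
          MvPowerSeries.C (W.a₁ * W.a₆) * W.formalIntercept ^ 2) *
        MvPowerSeries.invOfUnit (1 - MvPowerSeries.C W.a₃ * W.formalIntercept -
          MvPowerSeries.C W.a₆ * W.formalIntercept ^ 2) 1 +
        MvPowerSeries.C W.a₃ * (W.formalWDivCube.subst W.formalChordZ * W.formalChordZ ^ 2)) = 0 := by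
  have hs := WeierstrassCurve.hasSubst_zero_X (R := R)
  have hlam := W.subst_zero_X_formalSlope
  have hν := W.subst_zero_X_formalIntercept
  have hz := W.subst_zero_X_formalChordZ
  have hC : ∀ r : R, MvPowerSeries.subst ![(0 : R⟦X⟧), PowerSeries.X] (MvPowerSeries.C r) = PowerSeries.C r :=
    fun r ↦ by rw [MvPowerSeries.subst_C]; rfl
  have hB : MvPowerSeries.subst ![(0 : R⟦X⟧), PowerSeries.X] (W.formalWDivCube.subst W.formalChordZ) =
      W.formalWDivCube.subst W.formalNeg := by
    rw [mvSubst_powerSeries_subst W.hasSubst_formalChordZ hs, hz]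
  -- the unit `1 − a₃ν − a₆ν²` becomes `1` at `z₁ = 0`
  have hunit : MvPowerSeries.subst ![(0 : R⟦X⟧), PowerSeries.X]
      (MvPowerSeries.invOfUnit (1 - MvPowerSeries.C W.a₃ * W.formalIntercept -
        MvPowerSeries.C W.a₆ * W.formalIntercept ^ 2) 1) = 1 := by
    have hprod : (1 - MvPowerSeries.C W.a₃ * W.formalIntercept - MvPowerSeries.C W.a₆ * W.formalIntercept ^ 2) *
        MvPowerSeries.invOfUnit (1 - MvPowerSeries.C W.a₃ * W.formalIntercept -
          MvPowerSeries.C W.a₆ * W.formalIntercept ^ 2) 1 = 1 :=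
      MvPowerSeries.mul_invOfUnit _ 1 (by
        rw [Units.val_one, map_sub, map_sub, map_one, map_mul, map_mul, map_pow, W.constantCoeff_formalIntercept]
        simp)
    have := congrArg (MvPowerSeries.subst ![(0 : R⟦X⟧), PowerSeries.X]) hprod
    rw [← MvPowerSeries.coe_substAlgHom hs] at this
    simp only [map_mul, map_sub, map_one, map_pow] at this
    rw [MvPowerSeries.coe_substAlgHom hs, hν, hC, hC] at this
    simpa using this
  have hkey := formalWDivCube_subst_formalNeg_mul_sq W
  rw [← MvPowerSeries.coe_substAlgHom hs]
  simp only [map_add, map_neg, map_mul, map_pow]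
  rw [MvPowerSeries.coe_substAlgHom hs]
  simp only [hlam, hν, hz, hB, hunit, hC]
  linear_combination (PowerSeries.C W.a₃) * hkey

end Candidate

end Summit.BirchSwinnertonDyer.BirchSwinnertonDyer.Theorems.EtaSecondKind
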